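import Summits.HodgeConjecture.CorCM.Census.IcosicDihedralMinimality

/-!
# Icosic atlas, type `D₁₀` (second sequel): growth from the exceptional set — every coordinate vector lies in `X_L ⊔ P ⊔ A` (first half of the kernel
# certificate `μ(D₁₀) ≤ 66`; the lattice theorem is completed in `Census/IcosicDihedralLattice.lean`)

COR-CM (cell `pub-hodgecm2`), count-neutral kernel census by the literature seat lit-andre-3 (gen 15; claim ICOSIC-ATLAS; cell memo
`HOME/pub-hodgecm2-lit-andre-3/PORTFOLIO-lit-andre-3-g15.md`), second sequel of `Census/IcosicDihedralSpecies.lean` (imports `Census/IcosicDihedralMinimality.lean`; same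
conventions, dictionary, citations); method VERBATIM `Census/IcosicSplitGrowth.lean` (the exceptional-set form of the certificate): growth from the EXCEPTIONAL SET
`X = {F₂, F₃, F₄}` (`30` labels, `15` conjugate pairs) carrying the internal face `0` (all tables produced and verified by `scratch/leandata_d10.py`):
translations act linearly, `P` and `A` are translation stable; `W := X_L ⊔ (P ⊔ A)` is translation stable and contains every coordinate vector (`reach_spec`,
`single_mem_W`, `mem_W`); `X_L ≤ X_R ⊔ P` (`XL_le`) with `X_R` = the `42` coordinate vectors `e_{rep r}`, one per conjugate pair.
No named fact, no `sorry`.  HC_CM is not proved anywhere in this cell; nothing here is a headline.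

## References
* [Pohlmann1968] H. Pohlmann, Algebraic cycles on abelian varieties of complex multiplication type, Ann. of Math. 88 (1968), Thm 1.
* [Milne1999] J. S. Milne, Lefschetz motives and the Tate conjecture, Compositio Math. 117 (1999), Prop. 2.1, p. 54.
-/

namespace Summit.HodgeConjecture.CorCM.Census.IcosicDihedralSpecies

open Finset DihedralGroup

/-! ## Translations as linear maps; stability of `P` and `A` -/

/-- Translation by `g ∈ D₁₀` as a `ℤ`-linear map. [folklore] -/
def translL (g : G) : (Pt → ℤ) →ₗ[ℤ] (Pt → ℤ) where
  toFun := transl g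
  map_add' v w := by funext y; rfl
  map_smul' c v := by funext y; rfl

/-- Translates compose. [folklore] -/
theorem transl_transl (g h : G) (v : Pt → ℤ) : transl g (transl h v) = (transl (g * h) v : Pt → ℤ) := by
  funext y
  show v (act h⁻¹ (act g⁻¹ y)) = v (act (g * h)⁻¹ y)
  rw [← act_mul, mul_inv_rev]

/-- The translate of an indicator is the indicator of the translated set. [folklore] -/
theorem transl_ind (g : G) (S : Finset Pt) : transl g (ind S) = (ind (S.image (act g)) : Pt → ℤ) := by
  funext y
  show (if act g⁻¹ y ∈ S then (1 : ℤ) else 0) = if y ∈ S.image (act g) then 1 else 0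
  have key : act g⁻¹ y ∈ S ↔ y ∈ S.image (act g) := by
    rw [Finset.mem_image]
    constructor
    · intro h
      exact ⟨act g⁻¹ y, h, (actEquiv g).right_inv y⟩
    · rintro ⟨x, hx, rfl⟩
      rw [show act g⁻¹ (act g x) = x from (actEquiv g).left_inv x]
      exact hx
  by_cases h : act g⁻¹ y ∈ S
  · rw [if_pos h, if_pos (key.mp h)]
  · rw [if_neg h, if_neg (fun h' => h (key.mpr h'))]

/-- The translate of a coordinate vector. [folklore] -/
theorem transl_ind_singleton (g : G) (x : Pt) : transl g (ind {x}) = (ind {act g x} : Pt → ℤ) := by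
  rw [transl_ind, Finset.image_singleton]

/-- The complex conjugation `c = r 5`. [folklore] -/
abbrev cc : G := r 5

/-- `c = r 5` is central. [folklore] -/
theorem cc_comm : ∀ g : G, g * cc = cc * g := by decide

/-- The translate of a conjugate pair is a conjugate pair. [folklore] -/
theorem transl_pairVec (g : G) (x : Pt) : transl g (pairVec x) = (pairVec (act g x) : Pt → ℤ) := by
  rw [pairVec, transl_ind, Finset.image_insert, Finset.image_singleton, ← act_mul, cc_comm g, act_mul]
  rfl

/-- A span of a translation-stable family of generators is translation stable. [folklore] -/
theorem span_transl {ι : Type*} (f : ι → Pt → ℤ) (g : G)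
    (h : ∀ i, transl g (f i) ∈ Submodule.span ℤ (Set.range f)) {v : Pt → ℤ} (hv : v ∈ Submodule.span ℤ (Set.range f)) :
    transl g v ∈ (Submodule.span ℤ (Set.range f) : Submodule ℤ (Pt → ℤ)) := by
  have h1 : Submodule.map (translL g) (Submodule.span ℤ (Set.range f)) ≤ Submodule.span ℤ (Set.range f) := by
    rw [Submodule.map_span]
    refine Submodule.span_le.mpr ?_
    rintro _ ⟨_, ⟨i, rfl⟩, rfl⟩
    exact h i
  exact h1 (Submodule.mem_map_of_mem hv)

/-- `P` is translation stable. [folklore] -/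
theorem pairs_transl (g : G) {v : Pt → ℤ} (hv : v ∈ pairs) : transl g v ∈ (pairs : Submodule ℤ (Pt → ℤ)) :=
  span_transl pairVec g (fun x => by rw [transl_pairVec]; exact Submodule.subset_span ⟨act g x, rfl⟩) hv

/-- `A` is translation stable. [folklore] -/
theorem atoms_transl (g : G) {v : Pt → ℤ} (hv : v ∈ atoms) : transl g v ∈ (atoms : Submodule ℤ (Pt → ℤ)) :=
  span_transl (fun p : G × Fin 66 => transl p.1 (atomVec p.2)) g
    (fun p => by rw [transl_transl]; exact Submodule.subset_span ⟨(g * p.1, p.2), rfl⟩) hv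

/-! ## The exceptional set `X = {F₂, F₃, F₄}` and `W` -/

/-- Index set of the `30` labels of `X` (three fivefolds). [folklore] -/
abbrev XIdx := Fin 3 × ZMod 10

/-- The fivefolds of `X` as `t`-indices (blocks `2, 3, 4`). [folklore] -/
def xT : Fin 3 → Fin 30 := ![0, 1, 2]

/-- The labels of `X`. [folklore] -/
def xlab : XIdx → Pt
  | (j, u) => t (xT j) u

/-- `X_L`: the coordinate vectors of the labels of `X`. [folklore] -/
def XL : Submodule ℤ (Pt → ℤ) := Submodule.span ℤ (Set.range fun p : XIdx => ind {xlab p})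

set_option maxRecDepth 100000 in
/-- One representative per conjugate pair of `X` (`15` pairs): the cosets `t b u`, `u < 5`. [folklore] -/
def rep : Fin 15 → Pt :=
  ![t 0 0, t 0 1, t 0 2, t 0 3, t 0 4, t 1 0, t 1 1, t 1 2, t 1 3, t 1 4, t 2 0, t 2 1, t 2 2, t 2 3,
    t 2 4]

/-- `X_R`: one coordinate vector per conjugate pair of `X`. [folklore] -/
def XR : Submodule ℤ (Pt → ℤ) := Submodule.span ℤ (Set.range fun r : Fin 15 => ind {rep r})

/-- `W = X_L + P + A`. [folklore] -/
def W : Submodule ℤ (Pt → ℤ) := XL ⊔ (pairs ⊔ atoms)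

/-- `X` is a union of blocks: translates of labels of `X` are labels of `X`. [folklore] -/
theorem act_xlab (g : G) (p : XIdx) : ∃ p' : XIdx, act g (xlab p) = (xlab p' : Pt) := by
  rcases p with ⟨j, u⟩
  exact ⟨(j, if isRefl g then kF (xT j) - rot g - u else u + rot g), rfl⟩

/-- `X_L` is translation stable. [folklore] -/
theorem XL_transl (g : G) {v : Pt → ℤ} (hv : v ∈ XL) : transl g v ∈ (XL : Submodule ℤ (Pt → ℤ)) :=
  span_transl (fun p : XIdx => ind {xlab p}) g (fun p => by
    obtain ⟨p', hp'⟩ := act_xlab g p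
    rw [transl_ind_singleton, hp']
    exact Submodule.subset_span ⟨p', rfl⟩) hv

/-- `W` is translation stable. [folklore] -/
theorem W_transl (g : G) {v : Pt → ℤ} (hv : v ∈ W) : transl g v ∈ (W : Submodule ℤ (Pt → ℤ)) := by
  rw [W, Submodule.mem_sup] at hv
  obtain ⟨b, hb, w, hw, rfl⟩ := hv
  rw [Submodule.mem_sup] at hw
  obtain ⟨p, hp, a, ha, rfl⟩ := hw
  have e : transl g (b + (p + a)) = transl g b + (transl g p + transl g a) := by funext y; rfl
  rw [e]
  exact Submodule.add_mem _ (Submodule.mem_sup_left (XL_transl g hb))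
    (Submodule.mem_sup_right (Submodule.add_mem _ (Submodule.mem_sup_left (pairs_transl g hp)) (Submodule.mem_sup_right (atoms_transl g ha))))

/-- A conjugate pair is the sum of its two coordinate vectors. [folklore] -/
theorem pairVec_eq (x : Pt) : pairVec x = ind {x} + ind {act cc x} := by
  funext y
  show (if y ∈ ({x, act cc x} : Finset Pt) then (1 : ℤ) else 0) =
    (if y ∈ ({x} : Finset Pt) then 1 else 0) + (if y ∈ ({act cc x} : Finset Pt) then 1 else 0)
  simp only [Finset.mem_insert, Finset.mem_singleton]
  have hne : act cc x ≠ x := hodgeVec_conj.2 x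
  have hne' : x ≠ act cc x := fun e => hne e.symm
  by_cases h1 : y = x <;> by_cases h2 : y = act cc x <;> simp [h1, h2, hne, hne']

set_option maxRecDepth 100000 in set_option maxHeartbeats 4000000 in set_option synthInstance.maxHeartbeats 400000 in
/-- Every label of `X` is a representative or the conjugate of one; labels of step `0` are labels of `X`. [folklore] -/
theorem xlab_spec : (∀ p : XIdx, ∃ r : Fin 15, xlab p = rep r ∨ xlab p = act cc (rep r)) ∧
    (∀ x : Pt, rank.getD (blockOf x) 0 = 0 → ∃ p : XIdx, xlab p = x) := by
  refine ⟨by decide +kernel, by decide +kernel⟩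

/-- `X_L ≤ X_R ⊔ P`: the conjugate coordinate vectors are pair minus representative. [folklore] -/
theorem XL_le : XL ≤ (XR ⊔ pairs : Submodule ℤ (Pt → ℤ)) := by
  refine Submodule.span_le.mpr ?_
  rintro _ ⟨p, rfl⟩
  show ind {xlab p} ∈ XR ⊔ pairs
  obtain ⟨r, hr⟩ := xlab_spec.1 p
  rcases hr with h | h
  · rw [h]
    exact Submodule.mem_sup_left (Submodule.subset_span ⟨r, rfl⟩)
  · have e : ind {act cc (rep r)} = pairVec (rep r) - ind {rep r} := by
      rw [pairVec_eq]; exact (add_sub_cancel_left _ _).symm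
    rw [h, e]
    exact Submodule.sub_mem _ (Submodule.mem_sup_right (Submodule.subset_span ⟨rep r, rfl⟩))
      (Submodule.mem_sup_left (Submodule.subset_span ⟨r, rfl⟩))

/-! ## Every coordinate vector lies in `W` (growth from `X`) -/

set_option maxRecDepth 100000 in
/-- The label of growth face `k ≥ 4` in the block it introduces (for the internal face `0`: some label of the face, unused). [folklore] -/
def newLabel : Fin 66 → Pt :=
  ![t 0 0, q 0 (r 2), q 1 (r 5), q 3 (sr 7), q 25 (sr 2), q 4 (sr 6), q 6 (sr 6), q 12 (sr 8), q 2 (r 8), t 9 4, q 16 (r 8), q 17 (r 0), t 28 9, q 21 (r 8),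
    q 18 (r 4), q 19 (sr 0), q 8 (sr 4), q 5 (sr 0), q 14 (sr 6), q 13 (sr 7), t 6 9, q 15 (sr 8), q 11 (sr 9), q 22 (r 5), q 10 (sr 6), t 23 4, q 34 (r 9), t 29 8,
    q 35 (sr 0), q 29 (r 4), q 30 (r 6), t 16 2, q 27 (sr 0), t 17 7, t 20 4, t 13 5, t 25 3, q 26 (sr 6), t 26 8, t 27 8, q 33 (sr 3), q 31 (sr 3),
    q 24 (r 6), q 9 (r 0), q 28 (sr 0), t 7 1, t 14 0, q 7 (sr 7), t 3 9, q 20 (r 1), t 22 0, q 32 (r 2), t 24 4, t 15 0, q 23 (sr 4), t 5 0,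
    t 11 7, t 18 2, t 10 3, t 8 8, t 19 4, t 12 2, t 21 0, t 4 1, e 0 1, e 1 1]

/-- The growth face introducing a block (list indexed by block; `0` on the blocks of `X`). [folklore] -/
def kOfBlock : List ℕ :=
  [64, 65, 0, 0, 0, 48, 63, 55, 20, 45, 59, 9, 58, 56, 61, 35, 46, 53, 31, 33, 57, 60, 34, 62, 50, 25, 52, 36, 38, 39, 12, 27, 1, 2, 8, 3, 5, 17, 6, 47, 16, 43, 24, 22, 7, 19, 18, 21, 10, 11, 14, 15, 49, 13, 23, 54, 42, 4, 37, 32, 44, 29, 30, 41, 51, 40, 26, 28]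

/-- The face introducing the block of a label. [folklore] -/
def kOf (x : Pt) : Fin 66 := ⟨min (kOfBlock.getD (blockOf x) 0) 65, by omega⟩

/-- The translation carrying `newLabel (kOf x)` to `x` (a section of the quotient map of the block of `x`). [folklore] -/
def shOf (x : Pt) : G :=
  match x, newLabel (kOf x) with
  | Sum.inl (_, u), Sum.inl (_, u₀) => if u - u₀ = 0 then r 0 else r 1
  | Sum.inr (Sum.inl (_, u)), Sum.inr (Sum.inl (_, u₀)) => r (u - u₀)
  | Sum.inr (Sum.inr (_, h)), Sum.inr (Sum.inr (_, h₀)) => h * h₀⁻¹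
  | _, _ => 1

set_option maxRecDepth 100000 in set_option maxHeartbeats 4000000 in set_option synthInstance.maxHeartbeats 400000 in
/-- The growth structure re-read label by label: for a growth face `k ≥ 1`, `newLabel k` is one of its labels and its three other labels lie in blocks
of step `< stage k`; every label is of step `0` or the translate by `shOf` of the new label of the growth face reaching its block, at that step; no step
exceeds `65`. [folklore] -/
theorem reach_spec : (∀ k : Fin 66, 1 ≤ k.val → newLabel k ∈ orbitRep k) ∧
    (∀ k : Fin 66, 1 ≤ k.val → (((orbitRep k).erase (newLabel k)).filter fun y => ¬ rank.getD (blockOf y) 0 < stage k).card = 0) ∧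
    (∀ x : Pt, rank.getD (blockOf x) 0 = 0 ∨
      (act (shOf x) (newLabel (kOf x)) = x ∧ rank.getD (blockOf x) 0 = stage (kOf x) ∧ 1 ≤ (kOf x).val)) ∧
    (∀ x : Pt, rank.getD (blockOf x) 0 ≤ 65) := by
  refine ⟨by decide +kernel, by decide +kernel, by decide +kernel, by decide +kernel⟩

/-- A face monomial is its new label plus the coordinate vectors of its other labels. [folklore] -/
theorem atomVec_split (k : Fin 66) (h : newLabel k ∈ orbitRep k) :
    atomVec k = ind {newLabel k} + ∑ y ∈ (orbitRep k).erase (newLabel k), ind {y} := by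
  have hsum : ∀ S : Finset Pt, ind S = ∑ y ∈ S, ind {y} := by
    intro S
    funext z
    rw [Finset.sum_apply]
    show (if z ∈ S then (1 : ℤ) else 0) = ∑ y ∈ S, (if z ∈ ({y} : Finset Pt) then (1 : ℤ) else 0)
    simp only [Finset.mem_singleton]
    rw [Finset.sum_ite_eq]
  rw [atomVec, hsum, ← Finset.add_sum_erase _ _ h]

/-- **Every coordinate vector lies in `W`** (induction on the step at which the block of the label is reached from `X`). [folklore] -/
theorem single_mem_W (x : Pt) : (ind {x} : Pt → ℤ) ∈ W := by
  obtain ⟨hnew, hold, hreach, hbd⟩ := reach_spec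
  suffices h : ∀ n : ℕ, ∀ x : Pt, rank.getD (blockOf x) 0 ≤ n → ind {x} ∈ W from h 65 x (hbd x)
  intro n
  induction n with
  | zero =>
    intro x hx
    obtain ⟨p, rfl⟩ := xlab_spec.2 x (Nat.le_zero.mp hx)
    exact Submodule.mem_sup_left (Submodule.subset_span ⟨p, rfl⟩)
  | succ n ih =>
    intro x hx
    rcases Nat.lt_or_ge (rank.getD (blockOf x) 0) (n + 1) with hlt | hge
    · exact ih x (Nat.lt_succ_iff.mp hlt)
    · have heq : rank.getD (blockOf x) 0 = n + 1 := le_antisymm hx hge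
      rcases hreach x with h0 | ⟨hact, hrk, h4⟩
      · omega
      · set k := kOf x with hk
        have hnewW : ind {newLabel k} ∈ W := by
          have hrest : (∑ y ∈ (orbitRep k).erase (newLabel k), ind {y}) ∈ W := by
            refine Submodule.sum_mem _ fun y hy => ih y ?_
            have hlt := not_not.mp (Finset.filter_eq_empty_iff.mp (Finset.card_eq_zero.mp (hold k h4)) hy)
            omega
          have hA : atomVec k ∈ W := Submodule.mem_sup_right (Submodule.mem_sup_right (atomVec_mem k))
          have e : ind {newLabel k} = atomVec k - ∑ y ∈ (orbitRep k).erase (newLabel k), ind {y} := by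
            rw [atomVec_split k (hnew k h4)]; abel
          rw [e]
          exact Submodule.sub_mem _ hA hrest
        rw [← hact, ← transl_ind_singleton]
        exact W_transl _ hnewW

/-- `W` is everything. [folklore] -/
theorem mem_W : ∀ v : Pt → ℤ, v ∈ W := by
  intro v
  rw [pi_eq_sum_univ v]
  refine Submodule.sum_mem _ fun x _ => Submodule.smul_mem _ _ ?_
  have e : (fun y : Pt => if x = y then (1 : ℤ) else 0) = ind {x} := by
    funext y; simp only [ind, Finset.mem_singleton, eq_comm]
  rw [e]
  exact single_mem_W x

end Summit.HodgeConjecture.CorCM.Census.IcosicDihedralSpecies
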